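import Summits.Ventures.PercRepro.S2IndepFiveCount

/-!
# PercRepro — S2: THE INDEPENDENT `4`-SETS ARE FEWER THAN `C(n, 4)` BY THE TRIANGLES AND THE `4`-CIRCUITS (p7, gen 4; offered to S1)

The level-`4` analogue of S2IndepFiveCount, with NO overlap term: every triangle `T` with a point `x ∉ T` gives a dependent
`4`-set `T ∪ {x}`, and under (C1) a `4`-set contains at most one triangle (two would share two points), so the map is
injective; every `4`-circuit is a dependent `4`-set containing no triangle. Hence

  **`#{independent 4-sets} + s₃·(n − 3) + s₄ ≤ C(n, 4)`** (`ncard_indep_four_add_le`).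

The first term of every level-`4` count (`C(n, 4)`, S1 / the rank-`4` tails of S2) drops by `s₃·(n − 3) + s₄` with no new
matroid theory. Axioms: standard.
-/

open scoped Matroid

namespace PercRepro

namespace S2

open Set Finset

variable {α : Type} {M : Matroid α}

open scoped Classical in
/-- **The independent `4`-sets against the triangles and the `4`-circuits**:
`#{independent 4-sets} + s₃·(n − 3) + s₄ ≤ C(n, 4)` (`n = |E|`), under (C1). -/
theorem ncard_indep_four_add_le [M.Finite] (hC1 : ∀ L ⊆ M.E, M.eRk L = 2 → L.ncard ≤ 3) :
    {B : Set α | B ⊆ M.E ∧ B.ncard = 4 ∧ M.eRk B = 4}.ncard +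
      {C : Set α | M.IsCircuit C ∧ C.ncard = 3}.ncard * (M.E.ncard - 3) +
      {C : Set α | M.IsCircuit C ∧ C.ncard = 4}.ncard ≤ M.E.ncard.choose 4 := by
  classical
  set Ef := Matroid.groundF M with hEf
  have hE : (Ef : Set α) = M.E := Matroid.coe_groundF M
  have hEcard : Ef.card = M.E.ncard := Matroid.card_groundF M
  -- the triangles and the `4`-circuits, as finsets
  have hcircF : ∀ k : ℕ, ((Ef.powersetCard k).filter (fun C : Finset α => M.IsCircuit (C : Set α))).card =
      {C : Set α | M.IsCircuit C ∧ C.ncard = k}.ncard := by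
    intro k
    rw [← Matroid.card_circF]
    have himg : Matroid.circF M k =
        ((Ef.powersetCard k).filter (fun C : Finset α => M.IsCircuit (C : Set α))).image (fun s : Finset α => (s : Set α)) := by
      ext C
      rw [Matroid.mem_circF, Finset.mem_image]
      constructor
      · rintro ⟨hC, hCk⟩
        have hCfin : C.Finite := M.ground_finite.subset hC.subset_ground
        refine ⟨hCfin.toFinset, ?_, by simp⟩
        rw [Finset.mem_filter, Finset.mem_powersetCard]
        refine ⟨⟨?_, ?_⟩, by simpa using hC⟩
        · intro x hx
          rw [Set.Finite.mem_toFinset] at hx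
          rw [hEf, Matroid.groundF, Set.Finite.mem_toFinset]
          exact hC.subset_ground hx
        · rw [← Set.ncard_eq_toFinset_card C hCfin]; exact hCk
      · rintro ⟨s, hs, rfl⟩
        rw [Finset.mem_filter, Finset.mem_powersetCard] at hs
        exact ⟨hs.2, by rw [Set.ncard_coe_finset]; exact hs.1.2⟩
    rw [himg, Finset.card_image_of_injective _ Finset.coe_injective]
  set T3 : Finset (Finset α) := (Ef.powersetCard 3).filter (fun C : Finset α => M.IsCircuit (C : Set α)) with hT3def
  set C4 : Finset (Finset α) := (Ef.powersetCard 4).filter (fun C : Finset α => M.IsCircuit (C : Set α)) with hC4def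
  have hT3mem : ∀ T ∈ T3, M.IsCircuit (T : Set α) ∧ T.card = 3 ∧ T ⊆ Ef := by
    intro T hT
    rw [hT3def, Finset.mem_filter, Finset.mem_powersetCard] at hT
    exact ⟨hT.2, hT.1.2, hT.1.1⟩
  -- the dependent and the independent `4`-subsets
  set D4 : Finset (Finset α) := (Ef.powersetCard 4).filter (fun B : Finset α => ¬ M.Indep (B : Set α)) with hD4def
  set I4 : Finset (Finset α) := (Ef.powersetCard 4).filter (fun B : Finset α => M.Indep (B : Set α)) with hI4def
  have hID : I4.card + D4.card = Ef.card.choose 4 := by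
    rw [hI4def, hD4def, Finset.card_filter_add_card_filter_not, Finset.card_powersetCard]
  -- the triangle extensions `T ∪ {x}`, injectively
  set Pairs : Finset (Σ _ : Finset α, α) := T3.sigma (fun T => Ef \ T) with hPairsdef
  have hPairscard : Pairs.card = T3.card * (Ef.card - 3) := by
    rw [hPairsdef, Finset.card_sigma]
    have : ∀ T ∈ T3, (Ef \ T).card = Ef.card - 3 := by
      intro T hT
      rw [Finset.card_sdiff, Finset.inter_eq_left.2 (hT3mem T hT).2.2, (hT3mem T hT).2.1]
    rw [Finset.sum_congr rfl this, Finset.sum_const, smul_eq_mul]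
  set Ext : Finset (Finset α) := Pairs.image (fun x => insert x.2 x.1) with hExtdef
  have hExtcard : Ext.card = Pairs.card := by
    rw [hExtdef]
    apply Finset.card_image_of_injOn
    intro x hx y hy hxy
    simp only at hxy
    rw [Finset.mem_coe, hPairsdef, Finset.mem_sigma, Finset.mem_sdiff] at hx hy
    obtain ⟨hc1, h31, _⟩ := hT3mem _ hx.1
    obtain ⟨hc2, h32, _⟩ := hT3mem _ hy.1
    -- the two triangles lie in the same `4`-set, so they share `≥ 2` points: equal under (C1)
    have hTT : x.1 = y.1 := by
      by_contra hne
      have hi := card_inter_le_one_of_triangles hC1 hc1 h31 hc2 h32 hne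
      have hsub : x.1 ⊆ insert y.2 y.1 := by rw [← hxy]; exact Finset.subset_insert _ _
      have h4 : (insert y.2 y.1).card = 4 := by
        rw [Finset.card_insert_of_notMem hy.2.2, h32]
      -- `x.1 ⊆ y.1 ∪ {y.2}` with `|x.1 ∩ y.1| ≤ 1`: at most `2` points, contradiction
      have hx1sub : x.1 ⊆ (x.1 ∩ y.1) ∪ {y.2} := by
        intro a ha
        have := hsub ha
        rw [Finset.mem_insert] at this
        rcases this with h | h
        · exact Finset.mem_union.2 (Or.inr (by rw [Finset.mem_singleton]; exact h))
        · exact Finset.mem_union.2 (Or.inl (Finset.mem_inter.2 ⟨ha, h⟩))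
      have := Finset.card_le_card hx1sub
      have h2 := Finset.card_union_le (x.1 ∩ y.1) ({y.2} : Finset α)
      rw [Finset.card_singleton] at h2
      omega
    have hxx : x.2 = y.2 := by
      have hmem : x.2 ∈ insert y.2 y.1 := by rw [← hxy]; exact Finset.mem_insert_self _ _
      rw [Finset.mem_insert] at hmem
      rcases hmem with h | h
      · exact h
      · rw [← hTT] at h
        exact absurd h hx.2.2
    exact Sigma.ext hTT (heq_of_eq hxx)
  have hExtD : Ext ⊆ D4 := by
    intro B hB
    rw [hExtdef, Finset.mem_image] at hB
    obtain ⟨x, hx, rfl⟩ := hB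
    rw [hPairsdef, Finset.mem_sigma, Finset.mem_sdiff] at hx
    obtain ⟨hc, h3, hTE⟩ := hT3mem _ hx.1
    rw [hD4def, Finset.mem_filter, Finset.mem_powersetCard]
    refine ⟨⟨Finset.insert_subset hx.2.1 hTE, ?_⟩, ?_⟩
    · rw [Finset.card_insert_of_notMem hx.2.2, h3]
    · intro hind
      exact hc.not_indep (hind.subset (by rw [Finset.coe_insert]; exact Set.subset_insert _ _))
  have hC4D : C4 ⊆ D4 := by
    intro B hB
    rw [hC4def, Finset.mem_filter] at hB
    rw [hD4def, Finset.mem_filter]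
    exact ⟨hB.1, hB.2.not_indep⟩
  -- a `4`-circuit contains no triangle: `Ext` and `C4` are disjoint
  have hdisj : Disjoint Ext C4 := by
    rw [Finset.disjoint_left]
    intro B hB hB'
    rw [hExtdef, Finset.mem_image] at hB
    obtain ⟨x, hx, rfl⟩ := hB
    rw [hPairsdef, Finset.mem_sigma, Finset.mem_sdiff] at hx
    obtain ⟨hc, _, _⟩ := hT3mem _ hx.1
    rw [hC4def, Finset.mem_filter] at hB'
    have hss : (x.1 : Set α) ⊂ ((insert x.2 x.1 : Finset α) : Set α) := by
      rw [Finset.coe_insert]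
      exact Set.ssubset_insert (by exact_mod_cast hx.2.2)
    exact hc.not_indep (hB'.2.ssubset_indep hss)
  have hunion : Ext.card + C4.card ≤ D4.card := by
    rw [← Finset.card_union_of_disjoint hdisj]
    exact Finset.card_le_card (Finset.union_subset hExtD hC4D)
  -- the independent `4`-sets as a set of sets
  have hI4set : {B : Set α | B ⊆ M.E ∧ B.ncard = 4 ∧ M.eRk B = 4}.ncard = I4.card := by
    have himg : {B : Set α | B ⊆ M.E ∧ B.ncard = 4 ∧ M.eRk B = 4} =
        I4.image (fun s : Finset α => (s : Set α)) := by
      ext B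
      rw [Set.mem_setOf_eq, Finset.coe_image, Set.mem_image]
      constructor
      · rintro ⟨hBE, hB4, hBr⟩
        have hBfin : B.Finite := M.ground_finite.subset hBE
        refine ⟨hBfin.toFinset, ?_, by simp⟩
        rw [Finset.mem_coe, hI4def, Finset.mem_filter, Finset.mem_powersetCard]
        refine ⟨⟨?_, ?_⟩, ?_⟩
        · intro x hx
          rw [Set.Finite.mem_toFinset] at hx
          rw [hEf, Matroid.groundF, Set.Finite.mem_toFinset]
          exact hBE hx
        · rw [← Set.ncard_eq_toFinset_card B hBfin]; exact hB4
        · rw [Set.Finite.coe_toFinset]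
          rw [Matroid.indep_iff_eRk_eq_encard_of_finite hBfin, hBr, ← hBfin.cast_ncard_eq, hB4]
          rfl
      · rintro ⟨s, hs, rfl⟩
        rw [Finset.mem_coe, hI4def, Finset.mem_filter, Finset.mem_powersetCard] at hs
        refine ⟨?_, by rw [Set.ncard_coe_finset]; exact hs.1.2, ?_⟩
        · rw [← hE]; exact Finset.coe_subset.2 hs.1.1
        · rw [hs.2.eRk_eq_encard, Set.encard_coe_eq_coe_finsetCard, hs.1.2]
          rfl
    rw [himg, Finset.coe_image, Set.ncard_image_of_injective _ Finset.coe_injective, Set.ncard_coe_finset]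
  have hT3c : T3.card = {C : Set α | M.IsCircuit C ∧ C.ncard = 3}.ncard := hcircF 3
  have hC4c : C4.card = {C : Set α | M.IsCircuit C ∧ C.ncard = 4}.ncard := hcircF 4
  rw [hI4set, ← hT3c, ← hC4c, ← hEcard]
  have e1 : Ext.card = T3.card * (Ef.card - 3) := by rw [hExtcard, hPairscard]
  omega

end S2

end PercRepro
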